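import Literature.NumberTheory.GaloisRepresentations.PAdicHodge
import HarnessLib

/-!
# Discharges of named facts in `PAdicHodge.lean` (trunk GalRep, item C17)

D-0014 keeps `Literature/` sorry-free by stating cited results as named facts `def X : Prop`.
This sibling file proves the fact `Literature.NumberTheory.GaloisRepresentations.PeriodRingData.finrank_D_le` of
`Literature.NumberTheory.GaloisRepresentations.PAdicHodge` from the definitions alone, as
`theorem finrank_D_le_holds : 𝔅.finrank_D_le ρ`; users holding `(h : 𝔅.finrank_D_le ρ)` are fed
`𝔅.finrank_D_le_holds ρ`.

* `PeriodRingData.finrank_D_le_holds : 𝔅.finrank_D_le ρ` — **Fontaine's inequality**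
  `dim_E D_B(V) ≤ dim_P V` for a regular `(P, Γ)`-ring `B` with `B^Γ = E` and a
  finite-dimensional `P`-linear representation `V` of `Γ` (Fontaine, Astérisque 223 (1994),
  Exposé III, Prop. 1.4.2 and Thm. 1.5.2; reproduced with proof as Fontaine–Ouyang, *Theory of
  `p`-adic Galois representations*, §3.1.2, Def. 3.9 (regular `(F, G)`-rings) and Thm. 3.14 (1)).
* `PeriodRingData.linearIndependent_of_mem_D` — injectivity of the comparison map
  `α_V : B ⊗_E D_B(V) → B ⊗_P V`: `Γ`-invariant vectors of `B ⊗_P V` that are linearly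
  independent over `E` are linearly independent over `B`.
* `PeriodRingData.tensorRep_apply_smul` — the diagonal action is `B`-semilinear,
  `σ (b • x) = σ(b) • σ(x)`.

## Proof of `finrank_D_le`

The printed proof (Fontaine–Ouyang, Thm. 3.14 (1); Fontaine, Exposé III §1.4–1.5) first passes to
`C = Frac B`, using regularity (ii) `C^Γ = B^Γ = E`, and then shows by induction on `h` that
`x₁, …, x_h ∈ D_C(V)` linearly independent over `E` are linearly independent over `C`: normalise a
relation to `λ_h = -1`, apply `g ∈ G`, subtract, and conclude `g(λᵢ) = λᵢ` from the induction
hypothesis.  Here the same induction is run inside `B` (`linearIndependent_of_mem_D`, strong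
induction on the support `s` of a `B`-relation `∑ cᵢ xᵢ = 0` with some `c_j ≠ 0`): applying `σ`
(`tensorRep_apply_smul`) and eliminating `x_j` gives the relation
`∑_{i ≠ j} (c_j σ(cᵢ) - σ(c_j) cᵢ) xᵢ = 0` of smaller support, so `c_j σ(cᵢ) = σ(c_j) cᵢ` for all
`σ`; the fraction-free form `PeriodRingData.exists_smul_eq` of regularity (ii) then gives
`cᵢ = eᵢ c_j` with `eᵢ ∈ E`, hence `c_j • ∑ eᵢ xᵢ = 0`; since `B ⊗_P V ≅ B^d` is a free module over
the domain `B` (regularity (i)), it is torsion-free, so `∑ eᵢ xᵢ = 0`, forcing `e_j = 0` and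
`c_j = e_j c_j = 0`, a contradiction.  Finally `dim_E D_B(V) ≤ rank_B (B ⊗_P V) = dim_P V` by the
strong rank condition for the commutative ring `B` (`LinearIndependent.fintype_card_le_finrank`,
`Module.finrank_baseChange`).  Regularity (iii) (`isUnit_of_smul_mem`) and `invariants_eq` are not
used: as in the source, they only enter the equality case `dim_E D_B(V) = dim_P V ⇔ α_V iso`.

## Implementation note

Mathlib is built with `maxSynthPendingDepth 3` (its lakefile); this project uses the core
default `1`, under which nested instance problems on `𝔅.B ⊗[P] M` (the ring structure of `𝔅.B`
is a structure projection) fail spuriously — e.g. `rw [sub_smul]`, `LinearIndependent.map'`.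
The option is therefore set to Mathlib's value inside the section below.

## References

* J.-M. Fontaine, *Représentations `p`-adiques semi-stables*, in: Périodes `p`-adiques
  (Bures-sur-Yvette, 1988), Astérisque 223 (1994), 113–184, Exposé III, §1.4 (regular
  `(F, G)`-rings, Prop. 1.4.2), §1.5 (Thm. 1.5.2).  [FontaineAsterisque223III]
* J.-M. Fontaine, Y. Ouyang, *Theory of `p`-adic Galois Representations*, book draft (version
  of 2022-05-26), §3.1.2, Def. 3.9, Thm. 3.14.  [FontaineOuyang2022]
-/

noncomputable section

open scoped TensorProduct

namespace Literature.NumberTheory.GaloisRepresentations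

namespace PeriodRingData

section FinrankDLe

-- Mathlib's own global value (see the implementation note in the module docstring).
set_option maxSynthPendingDepth 3

universe u v v' w w'

variable {Γ : Type u} [Group Γ] [TopologicalSpace Γ] {P : Type v} {E : Type v'} [Field P]
  [TopologicalSpace P] [Field E] [Algebra P E]
  {M : Type w'} [AddCommGroup M] [Module P M] [TopologicalSpace M]
  (𝔅 : PeriodRingData.{u, v, v', w} Γ P E) (ρ : ContinuousRep Γ P M)

/-- The diagonal action on `B ⊗_P V` is semilinear for the `B`-module structure:
`σ (b • x) = σ(b) • σ(x)`.
Ref: Fontaine, Astérisque 223 (1994), Exposé III §1.3 (`B`-representations). [folklore] -/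
lemma tensorRep_apply_smul (σ : Γ) (b : 𝔅.B) (x : 𝔅.B ⊗[P] M) :
    𝔅.tensorRep ρ σ (b • x) = (σ • b) • 𝔅.tensorRep ρ σ x := by
  induction x using TensorProduct.induction_on with
  | zero => simp
  | tmul b' m => simp [TensorProduct.smul_tmul', smul_mul']
  | add x y hx hy => simp [smul_add, map_add, hx, hy]

/-- **Injectivity of Fontaine's comparison map** `α_V : B ⊗_E D_B(V) → B ⊗_P V` for a regular
`(P, Γ)`-ring `B`, in the form: a family of `Γ`-invariant vectors of `B ⊗_P V` which is linearly
independent over `E = B^Γ` is linearly independent over `B`.  Only regularity (i) (`B` is a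
domain) and (ii) (`PeriodRingData.exists_smul_eq`) are used.
Ref: Fontaine, Astérisque 223 (1994), Exposé III, Prop. 1.4.2 / Thm. 1.5.2 (`α_V` injective);
Fontaine–Ouyang, Thm. 3.14 (1) and its proof.
[cite: FontaineAsterisque223III, Thm. 1.5.2] [cite: FontaineOuyang2022, Thm. 3.14] -/
theorem linearIndependent_of_mem_D {ι : Type*} {x : ι → 𝔅.B ⊗[P] M}
    (hx : ∀ i, x i ∈ 𝔅.D ρ) (hli : LinearIndependent E x) :
    LinearIndependent 𝔅.B x := by
  classical
  rw [linearIndependent_iff'] at hli ⊢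
  intro s
  induction s using Finset.strongInduction with
  | H s ih =>
    intro c hc
    by_contra! hne
    obtain ⟨j, hjs, hj⟩ := hne
    -- Step 1: the quotients `c i / c j` are `Γ`-invariant (shorter relation + induction).
    have key : ∀ σ : Γ, ∀ i ∈ s, c j * σ • c i = σ • c j * c i := by
      intro σ
      have hσ : ∑ i ∈ s, (σ • c i) • x i = 0 := by
        have h := congrArg (𝔅.tensorRep ρ σ) hc
        rw [map_sum, map_zero] at h
        calc ∑ i ∈ s, (σ • c i) • x i = ∑ i ∈ s, 𝔅.tensorRep ρ σ (c i • x i) :=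
              Finset.sum_congr rfl fun i _ => by
                rw [tensorRep_apply_smul, (𝔅.mem_D_iff ρ (x i)).mp (hx i) σ]
          _ = 0 := h
      have hj0 : (c j * σ • c j - σ • c j * c j) • x j = 0 := by
        rw [mul_comm, sub_self, zero_smul]
      have hsum : ∑ i ∈ s.erase j, (c j * σ • c i - σ • c j * c i) • x i = 0 := by
        rw [Finset.sum_erase s hj0]
        simp only [sub_smul, Finset.sum_sub_distrib, mul_smul, ← Finset.smul_sum, hc, hσ,
          smul_zero, sub_self]
      have h' := ih (s.erase j) (Finset.erase_ssubset hjs) _ hsum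
      intro i hi
      by_cases hij : i = j
      · subst hij; exact mul_comm _ _
      · exact sub_eq_zero.mp (h' i (Finset.mem_erase.mpr ⟨hij, hi⟩))
    -- Step 2: regularity (ii) gives `c i = e i • c j` with `e i ∈ E`.
    have he : ∀ i ∈ s, ∃ e : E, c i = e • c j := fun i hi =>
      𝔅.exists_smul_eq (c i) (c j) hj fun σ => by
        rw [mul_comm (σ • c i), key σ i hi, mul_comm]
    choose! e he using he
    -- Step 3: `c j • ∑ e i • x i = 0`, hence `∑ e i • x i = 0` by torsion-freeness of the free
    -- `B`-module `B ⊗[P] M` over the domain `B`; then `e j = 0`, so `c j = 0`: contradiction.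
    have hsum : c j • ∑ i ∈ s, e i • x i = 0 := by
      rw [Finset.smul_sum, ← hc]
      refine Finset.sum_congr rfl fun i hi => ?_
      rw [← smul_comm (e i) (c j) (x i), ← smul_assoc, ← he i hi]
    rw [smul_eq_zero_iff_right hj] at hsum
    have hej : e j = 0 := hli s e hsum j hjs
    exact hj (by rw [he j hjs, hej, zero_smul])

/-- **Fontaine's inequality holds**: `dim_E D_B(V) ≤ dim_P V` for every period-ring datum
(regular `(P, Γ)`-ring) `𝔅` and every finite-dimensional `P`-linear continuous representation
`ρ` of `Γ` on `V = M`, discharging the named fact `PeriodRingData.finrank_D_le`.  Proof: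
`E`-linearly independent vectors of `D = (B ⊗_P V)^Γ` are `B`-linearly independent
(`linearIndependent_of_mem_D`), and `rank_B (B ⊗_P V) = dim_P V`.
Ref: Fontaine, Astérisque 223 (1994), Exposé III, Prop. 1.4.2 and Thm. 1.5.2; Fontaine–Ouyang,
*Theory of `p`-adic Galois representations*, Thm. 3.14 (1).
[cite: FontaineAsterisque223III, Prop. 1.4.2 and Thm. 1.5.2] [cite: FontaineOuyang2022, Thm. 3.14] -/
theorem finrank_D_le_holds : 𝔅.finrank_D_le ρ := by
  intro _
  refine Module.finrank_le_of_rank_le (rank_le fun s hs => ?_)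
  have h1 : LinearIndependent E (fun i : s => ((i : 𝔅.D ρ) : 𝔅.B ⊗[P] M)) :=
    hs.map' (𝔅.D ρ).subtype (Submodule.ker_subtype _)
  have h2 : LinearIndependent 𝔅.B (fun i : s => ((i : 𝔅.D ρ) : 𝔅.B ⊗[P] M)) :=
    𝔅.linearIndependent_of_mem_D ρ (fun i => (i : 𝔅.D ρ).2) h1
  have h3 := h2.fintype_card_le_finrank
  rw [Fintype.card_coe] at h3
  exact h3.trans_eq Module.finrank_baseChange

end FinrankDLe

end PeriodRingData

end Literature.NumberTheory.GaloisRepresentations
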